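import Literature.AlgebraicGeometry.Motives.FieldPointBaseChange
import Literature.AlgebraicGeometry.Motives.SectionsFieldPointBaseChange
import Literature.AlgebraicGeometry.Motives.RatFnAffine
import HarnessLib

/-!
# The rational point of `X_L` attached to an `L`-valued point of `X`, and its ideal

Let `X` be a `K`-scheme, `π : Spec L → Spec K` a field-valued point of the base and
`Q : Spec L → X` an `L`-valued point of `X` over `K` (`Q : Over.mk π ⟶ X`). On the base change
`X_L = X ×_K Spec L = (X ⊗ Over.mk π).left` the point `Q` becomes the **`L`-rational point**
`ratPt X π Q = (Q, 𝟙) : Spec L → X_L` (Görtz–Wedhorn I, (4.11)/(5.3): `X(L) = X_L(L)`), a closed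
immersion when `X` is separated. This file computes its ideal on the affine charts
`pr⁻¹U = U ×_K Spec L` (`U ∋ Q` affine), the input for the fibres of the diagonal / graph divisors of
`Motives/CurveDiagonalDivisor` (Milne, *Jacobian Varieties*, §3, Example 3.12):

* `ker_lift_id_eq_span` — algebra: for an `A`-algebra map `χ : B → L`, the kernel of
  `L ⊗_A B → L`, `l ⊗ b ↦ l χ(b)`, is generated by the `1 ⊗ b − χ(b) ⊗ 1`;
* `FieldPoint.ratPt`, `ratPtPoint`, `isClosedImmersion_ratPt`, `isClosed_ratPtPoint` (namespace
  `FieldPoint`; the tree's `ratPt` of `Motives/KunnethSliceSections` is the point of a `k`-rational point);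
* `evalRatPt` (evaluation `Γ(pr⁻¹U, 𝒪_{X_L}) → L` at the rational point), `kFun a = pr^♯(a) − a(Q)`,
  `evalRatPt_appLE`, `evalRatPt_strMap`, `evalAtFieldPoint_appLE_top`;
* **`ker_evalRatPt_eq_span`** — the kernel of the evaluation is generated by the `k_a`
  (through the affine base change `Γ(pr⁻¹U, 𝒪_{X_L}) ≅ L ⊗_K Γ(U, 𝒪_X)` of
  `Motives/SectionsFieldPointBaseChange`, `FieldPointBaseChange.tensorIso`);
* `ker_evalRatPt_eq_primeIdealOf` (it is the prime of the rational point),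
  **`exists_isUnit_germ_kFun`** (off the rational point some `k_a` is a unit) and
  **`span_germ_kFun_eq_maximalIdeal`** (at the rational point the `k_a` generate `𝔪_{X_L, pt}`).

Everything is proved; no named facts (D-0026).

Mathlib searched (pin): `Algebra.TensorProduct.lift`, `TensorProduct.induction_on`,
`pullback.lift`, `IsClosedImmersion.of_comp`, `Scheme.stalkClosedPointTo`,
`Scheme.germ_stalkClosedPointTo_Spec`, `isUnit_map_iff`, `IsLocalization.AtPrime.to_map_mem_maximal_iff`,
`IsLocalization.AtPrime.map_eq_maximalIdeal`, `RingHom.ker_isMaximal_of_surjective`,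
`IsAffineOpen.fromSpec_primeIdealOf` (all used).

## References

* U. Görtz, T. Wedhorn, *Algebraic Geometry I: Schemes*, 2nd ed. (2020), (4.11), (5.3)
  (`S`-valued points and base change). [GortzWedhorn2020]
* J. S. Milne, *Jacobian Varieties*, in: Arithmetic Geometry (Cornell–Silverman, eds.), Springer
  1986, §3 Example 3.12. [Milne1986JacobianVarieties]
-/

noncomputable section

open CategoryTheory CategoryTheory.Limits AlgebraicGeometry IsLocalRing TopologicalSpace
  MonoidalCategory CartesianMonoidalCategory TensorProduct

universe u

namespace Literature.AlgebraicGeometry.Motives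

/-! ### Algebra: the kernel of the evaluation `L ⊗_A B → L` at an `L`-point of `B` -/

section Algebra

variable {A L B : Type*} [CommRing A] [CommRing L] [CommRing B] [Algebra A L] [Algebra A B]

/-- **The kernel of `L ⊗_A B → L`, `l ⊗ b ↦ l · χ(b)`, is generated by the `1 ⊗ b − χ(b) ⊗ 1`**
(the ideal of the `L`-rational point of `Spec (L ⊗_A B) = Spec B ×_A Spec L` defined by an
`A`-algebra map `χ : B → L`). [folklore] -/
theorem ker_lift_id_eq_span (χ : B →ₐ[A] L) :
    RingHom.ker (Algebra.TensorProduct.lift (AlgHom.id A L) χ (fun _ _ ↦ Commute.all _ _)).toRingHom =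
      Ideal.span (Set.range fun b : B ↦ (1 : L) ⊗ₜ[A] b - χ b ⊗ₜ[A] (1 : B)) := by
  set ε := Algebra.TensorProduct.lift (AlgHom.id A L) χ (fun _ _ ↦ Commute.all _ _) with hε
  set I := Ideal.span (Set.range fun b : B ↦ (1 : L) ⊗ₜ[A] b - χ b ⊗ₜ[A] (1 : B)) with hI
  -- every `x` is congruent to `ε(x) ⊗ 1` modulo `I`
  have key : ∀ x : L ⊗[A] B, x - ε x ⊗ₜ[A] (1 : B) ∈ I := by
    intro x
    induction x using TensorProduct.induction_on with
    | zero => simp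
    | tmul l b =>
      have e : l ⊗ₜ[A] b - ε (l ⊗ₜ[A] b) ⊗ₜ[A] (1 : B) =
          (l ⊗ₜ[A] (1 : B)) * ((1 : L) ⊗ₜ[A] b - χ b ⊗ₜ[A] (1 : B)) := by
        simp only [hε, Algebra.TensorProduct.lift_tmul, AlgHom.coe_id, id_eq, mul_sub,
          Algebra.TensorProduct.tmul_mul_tmul, mul_one, one_mul]
      rw [e]
      exact Ideal.mul_mem_left _ _ (Ideal.subset_span ⟨b, rfl⟩)
    | add x y hx hy =>
      have e : x + y - ε (x + y) ⊗ₜ[A] (1 : B) = (x - ε x ⊗ₜ[A] 1) + (y - ε y ⊗ₜ[A] 1) := by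
        rw [map_add, TensorProduct.add_tmul]; abel
      rw [e]
      exact I.add_mem hx hy
  apply le_antisymm
  · intro x hx
    have h0 : ε x = 0 := hx
    have := key x
    rwa [h0, TensorProduct.zero_tmul, sub_zero] at this
  · rw [hI, Ideal.span_le]
    rintro _ ⟨b, rfl⟩
    change ε _ = 0
    simp [hε]

end Algebra

/-! ### The rational point of the base change -/

namespace FieldPoint

variable {K : Type u} [Field K] (X : SchemeOver K) {L : Type u} [Field L]
  (π : Spec (.of L) ⟶ Spec (.of K)) (Q : Over.mk π ⟶ X)

/-- The first projection `X_L = X ×_K Spec L → X`. [folklore] -/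
abbrev fieldPointFst : (X ⊗ Over.mk π).left ⟶ X.left := pullback.fst X.hom π

/-- **The `L`-rational point of `X_L` attached to the `L`-valued point `Q` of `X`**: the section
`(Q, 𝟙) : Spec L → X ×_K Spec L` of `X_L → Spec L` (Görtz–Wedhorn I, (4.1)/(5.3):
`X(L) = X_L(L)`). [folklore] -/
def ratPt : Spec (.of L) ⟶ (X ⊗ Over.mk π).left :=
  pullback.lift Q.left (𝟙 _) (by erw [Category.id_comp]; exact Over.w Q)

/-- The rational point lies over `Q`. [folklore] -/
@[reassoc (attr := simp)]
theorem ratPt_fst : ratPt X π Q ≫ fieldPointFst X π = Q.left := pullback.lift_fst _ _ _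

/-- The rational point is a section of `X_L → Spec L`. [folklore] -/
@[reassoc (attr := simp)]
theorem ratPt_snd : ratPt X π Q ≫ fieldPointStr X π = 𝟙 _ := pullback.lift_snd _ _ _

/-- The point of `X_L` underlying the rational point (an `abbrev`, so that stalks at it are stalks at
`ratPt _ (closedPoint L)` reducibly). [folklore] -/
abbrev ratPtPoint : (X ⊗ Over.mk π).left := ratPt X π Q (closedPoint L)

/-- The rational point lies over the image point of `Q`. [folklore] -/
theorem fieldPointFst_ratPtPoint :
    fieldPointFst X π (ratPtPoint X π Q) = Q.left (closedPoint L) := by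
  have h := congrArg (fun f : Spec (.of L) ⟶ X.left ↦ f (closedPoint L)) (ratPt_fst X π Q)
  exact h

/-- The rational point is a closed immersion when `X` is separated over `K` (a section of the
separated `X_L → Spec L`). [folklore] -/
instance isClosedImmersion_ratPt [IsSeparated X.hom] : IsClosedImmersion (ratPt X π Q) := by
  haveI : IsSeparated (fieldPointStr X π) := inferInstanceAs (IsSeparated (pullback.snd X.hom π))
  haveI : IsClosedImmersion (ratPt X π Q ≫ fieldPointStr X π) := by
    rw [ratPt_snd]; infer_instance
  exact IsClosedImmersion.of_comp (ratPt X π Q) (fieldPointStr X π)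

/-- The rational point is a closed point (for `X` separated over `K`). [folklore] -/
theorem isClosed_ratPtPoint [IsSeparated X.hom] :
    IsClosed ({ratPtPoint X π Q} : Set (X ⊗ Over.mk π).left) := by
  have h : Set.range (ratPt X π Q) = {ratPtPoint X π Q} := by
    ext y
    simp only [Set.mem_range, Set.mem_singleton_iff, ratPtPoint]
    constructor
    · rintro ⟨s, rfl⟩; rw [Subsingleton.elim s (closedPoint L)]
    · rintro rfl; exact ⟨_, rfl⟩
  rw [← h]
  exact (ratPt X π Q).isClosedEmbedding.isClosed_range

/-! ### The ideal of the rational point on an affine chart -/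

variable {U : X.left.Opens}

/-- The rational point lies in the chart `pr⁻¹U` when `Q ∈ U`. [folklore] -/
theorem ratPtPoint_mem (hQU : Q.left (closedPoint L) ∈ U) : ratPtPoint X π Q ∈ fieldPointFst X π ⁻¹ᵁ U := by
  change fieldPointFst X π (ratPtPoint X π Q) ∈ U
  rw [fieldPointFst_ratPtPoint]; exact hQU

variable (U) in
/-- The chart `pr⁻¹U` of `X_L` is affine (base change of the affine `U` to `L`). [folklore] -/
theorem isAffineOpen_preimage_fieldPointFst (hU : IsAffineOpen U) : IsAffineOpen (fieldPointFst X π ⁻¹ᵁ U) := by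
  haveI : IsAffineHom (fieldPointFst X π) := MorphismProperty.pullback_fst _ _ inferInstance
  exact hU.preimage (fieldPointFst X π)

variable (U) in
/-- The structure map `L → Γ(pr⁻¹U, 𝒪_{X_L})`. [folklore] -/
def strMap : L →+* Γ((X ⊗ Over.mk π).left, fieldPointFst X π ⁻¹ᵁ U) :=
  ((Scheme.ΓSpecIso (.of L)).inv ≫ (fieldPointStr X π).appLE ⊤ (fieldPointFst X π ⁻¹ᵁ U) le_top).hom

/-- Evaluation at the rational point: `Γ(pr⁻¹U, 𝒪_{X_L}) → L`. [folklore] -/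
def evalRatPt (hQU : Q.left (closedPoint L) ∈ U) : Γ((X ⊗ Over.mk π).left, fieldPointFst X π ⁻¹ᵁ U) →+* L :=
  evalAtFieldPoint (ratPt X π Q) (fieldPointFst X π ⁻¹ᵁ U) (ratPtPoint_mem X π Q hQU)

/-- The functions `k_a = pr^♯(a) − a(Q) · 1` on `pr⁻¹U`, for `a ∈ Γ(U, 𝒪_X)`. [folklore] -/
def kFun (hQU : Q.left (closedPoint L) ∈ U) (a : Γ(X.left, U)) :
    Γ((X ⊗ Over.mk π).left, fieldPointFst X π ⁻¹ᵁ U) :=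
  (fieldPointFst X π).appLE U (fieldPointFst X π ⁻¹ᵁ U) le_rfl a -
    strMap X π U (evalAtFieldPoint Q.left U hQU a)

/-- Evaluation at the rational point of a pulled-back function is evaluation at `Q`. [folklore] -/
theorem evalRatPt_appLE (hQU : Q.left (closedPoint L) ∈ U) (a : Γ(X.left, U)) :
    evalRatPt X π Q hQU ((fieldPointFst X π).appLE U (fieldPointFst X π ⁻¹ᵁ U) le_rfl a) =
      evalAtFieldPoint Q.left U hQU a := by
  have h := evalAtFieldPoint_comp (ratPt X π Q) (fieldPointFst X π) U
    (show (ratPt X π Q ≫ fieldPointFst X π) (closedPoint L) ∈ U by rw [ratPt_fst]; exact hQU) a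
  rw [evalAtFieldPoint_congr (ratPt_fst X π Q) U _ hQU, Scheme.Hom.app_eq_appLE] at h
  exact h.symm

omit [Field K] in
/-- Evaluation at the identity point `Spec L → Spec L` is `Γ(Spec L, 𝒪) ≅ L` (as
`evalAtFieldPoint_id_top` of `Motives/TrivialLocusFieldDescent`, whose homological import closure is
not wanted here; kept private). [folklore] -/
private theorem evalAtFieldPoint_id_top'
    (h : (𝟙 (Spec (.of L)) : Spec (.of L) ⟶ _) (closedPoint L) ∈ (⊤ : (Spec (CommRingCat.of L)).Opens))
    (a : Γ(Spec (.of L), ⊤)) :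
    evalAtFieldPoint (𝟙 (Spec (.of L))) ⊤ h a = (Scheme.ΓSpecIso (.of L)).hom.hom a := by
  rw [evalAtFieldPoint_congr (Spec.map_id (CommRingCat.of L)).symm ⊤ h trivial]
  change ((Spec (.of L)).presheaf.germ ⊤ _ trivial ≫
    Scheme.stalkClosedPointTo (Spec.map (𝟙 (CommRingCat.of L)))) a = _
  rw [Scheme.germ_stalkClosedPointTo_Spec]
  rfl

/-- Evaluation at the rational point of a constant is that constant. [folklore] -/
theorem evalRatPt_strMap (hQU : Q.left (closedPoint L) ∈ U) (l : L) :
    evalRatPt X π Q hQU (strMap X π U l) = l := by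
  have h1 := evalAtFieldPoint_comp (ratPt X π Q) (fieldPointStr X π) ⊤
    (show (ratPt X π Q ≫ fieldPointStr X π) (closedPoint L) ∈ (⊤ : (Spec (.of L)).Opens) from
      trivial) ((Scheme.ΓSpecIso (.of L)).inv l)
  rw [evalAtFieldPoint_congr (ratPt_snd X π Q) ⊤ _ trivial, evalAtFieldPoint_id_top'] at h1
  have e : (Scheme.ΓSpecIso (.of L)).hom.hom ((Scheme.ΓSpecIso (.of L)).inv l) = l :=
    congrArg (fun f : CommRingCat.of L ⟶ CommRingCat.of L ↦ f l)
      (Scheme.ΓSpecIso (.of L)).inv_hom_id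
  rw [e] at h1
  have h2 := evalAtFieldPoint_map (ratPt X π Q)
    (show fieldPointFst X π ⁻¹ᵁ U ≤ fieldPointStr X π ⁻¹ᵁ ⊤ from le_top)
    (ratPtPoint_mem X π Q hQU) ((fieldPointStr X π).app ⊤ ((Scheme.ΓSpecIso (.of L)).inv l))
  exact h2.trans h1.symm

/-- Evaluation at `Q` of a constant `c ∈ Γ(Spec K, 𝒪)` pulled back to `U` is its pullback along
`π : Spec L → Spec K`. [folklore] -/
theorem evalAtFieldPoint_appLE_top (hQU : Q.left (closedPoint L) ∈ U) (c : Γ(Spec (.of K), ⊤)) :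
    evalAtFieldPoint Q.left U hQU (X.hom.appLE ⊤ U le_top c) =
      (π.appLE ⊤ ⊤ le_rfl ≫ (Scheme.ΓSpecIso (.of L)).hom) c := by
  have hw : Q.left ≫ X.hom = π := Over.w Q
  have h1₀ := evalAtFieldPoint_comp Q.left X.hom ⊤
    (show (Q.left ≫ X.hom) (closedPoint L) ∈ (⊤ : (Spec (.of K)).Opens) from trivial) c
  have hcongr := evalAtFieldPoint_congr hw ⊤
    (show (Q.left ≫ X.hom) (closedPoint L) ∈ (⊤ : (Spec (.of K)).Opens) from trivial) trivial
  have h1 := (DFunLike.congr_fun hcongr c).symm.trans h1₀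
  have h2 := appLE_ΓSpecIso_eq_evalAtFieldPoint π ⊤ trivial
  have h2c := congrArg (fun f : Γ(Spec (.of K), ⊤) ⟶ CommRingCat.of L ↦ f c) h2
  change (Scheme.ΓSpecIso (.of L)).hom.hom (π.appLE ⊤ ⊤ le_rfl c) = evalAtFieldPoint π ⊤ trivial c at h2c
  change _ = (Scheme.ΓSpecIso (.of L)).hom.hom (π.appLE ⊤ ⊤ le_rfl c)
  rw [h2c, h1]
  have h3 := evalAtFieldPoint_map Q.left (show U ≤ X.hom ⁻¹ᵁ ⊤ from le_top) hQU (X.hom.app ⊤ c)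
  exact h3

/-- **The ideal of the rational point is generated by the `k_a`**: on the affine chart `pr⁻¹U`
(`U ∋ Q` affine), the kernel of the evaluation at the `L`-rational point of `X_L` attached to `Q` is
the ideal generated by the functions `pr^♯(a) − a(Q)`, `a ∈ Γ(U, 𝒪_X)` (through the affine base
change `Γ(pr⁻¹U, 𝒪_{X_L}) ≅ L ⊗_K Γ(U, 𝒪_X)`, `FieldPointBaseChange.tensorIso`, and
`ker_lift_id_eq_span`). [folklore] -/
theorem ker_evalRatPt_eq_span (hU : IsAffineOpen U) (hQU : Q.left (closedPoint L) ∈ U) :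
    RingHom.ker (evalRatPt X π Q hQU) = Ideal.span (Set.range (kFun X π Q hQU)) := by
  classical
  -- the algebra structures of `FieldPointBaseChange`
  letI algL : Algebra Γ(Spec (.of K), ⊤) L :=
    (π.appLE ⊤ ⊤ le_rfl ≫ (Scheme.ΓSpecIso (.of L)).hom).hom.toAlgebra
  letI algU : Algebra Γ(Spec (.of K), ⊤) Γ(X.left, U) := (X.hom.appLE ⊤ U le_top).hom.toAlgebra
  letI algZ : Algebra L Γ((X ⊗ Over.mk π).left, fieldPointFst X π ⁻¹ᵁ U) :=
    (strMap X π U).toAlgebra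
  have H : IsPullback (fieldPointFst X π) (fieldPointStr X π) X.hom π :=
    IsPullback.of_hasPullback X.hom π
  let e := FieldPointBaseChange.tensorIso H (V := ⊤) le_rfl rfl (W := U) le_top rfl
    (prZ := fieldPointStr X π) rfl (isAffineOpen_top _) hU
  -- the evaluation character of `Γ(U, 𝒪_X)` at `Q`, as an algebra map
  let χ : Γ(X.left, U) →ₐ[Γ(Spec (.of K), ⊤)] L :=
    { evalAtFieldPoint Q.left U hQU with
      commutes' := fun c ↦ evalAtFieldPoint_appLE_top X π Q hQU c }
  set ε := Algebra.TensorProduct.lift (AlgHom.id (Γ(Spec (.of K), ⊤)) L) χ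
    (fun _ _ ↦ Commute.all _ _) with hε
  -- `ev ∘ e = ε`
  have key : ∀ x, evalRatPt X π Q hQU (e.hom x) = ε x := by
    intro x
    induction x using TensorProduct.induction_on with
    | zero => rw [map_zero, map_zero, map_zero]
    | tmul l r =>
      rw [FieldPointBaseChange.tensorIso_tmul, map_mul, hε, Algebra.TensorProduct.lift_tmul]
      change evalRatPt X π Q hQU (strMap X π U l) *
        evalRatPt X π Q hQU ((fieldPointFst X π).appLE U (fieldPointFst X π ⁻¹ᵁ U) le_rfl r) = _
      rw [evalRatPt_strMap, evalRatPt_appLE]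
      rfl
    | add x y hx hy => rw [map_add, map_add, hx, hy, map_add]
  -- transport the kernel along the isomorphism `e`
  have hker : RingHom.ker (evalRatPt X π Q hQU) =
      Ideal.map e.hom.hom (RingHom.ker ε.toRingHom) := by
    apply le_antisymm
    · intro s hs
      obtain ⟨x, rfl⟩ := e.commRingCatIsoToRingEquiv.surjective s
      change e.hom.hom x ∈ _
      apply Ideal.mem_map_of_mem
      change ε x = 0
      rw [← key]; exact hs
    · rw [Ideal.map_le_iff_le_comap]
      intro x hx
      change evalRatPt X π Q hQU (e.hom x) = 0
      rw [key]; exact hx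
  rw [hker, ker_lift_id_eq_span χ, Ideal.map_span]
  congr 1
  ext s
  simp only [Set.mem_image, Set.mem_range, exists_exists_eq_and]
  refine exists_congr fun a ↦ ?_
  have : e.hom.hom ((1 : L) ⊗ₜ a - χ a ⊗ₜ (1 : Γ(X.left, U))) = kFun X π Q hQU a := by
    rw [map_sub, FieldPointBaseChange.tensorIso_tmul, FieldPointBaseChange.tensorIso_tmul,
      map_one, one_mul, map_one, mul_one]
    rfl
  rw [this]

/-- Evaluation at the rational point is surjective. [folklore] -/
theorem evalRatPt_surjective (hQU : Q.left (closedPoint L) ∈ U) :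
    Function.Surjective (evalRatPt X π Q hQU) :=
  fun l ↦ ⟨strMap X π U l, evalRatPt_strMap X π Q hQU l⟩

/-- The rational point, as a point of the chart `pr⁻¹U` (a `def`: stalks at `↑(ratPtV …)` then carry
Mathlib's `Γ(pr⁻¹U, 𝒪)`-algebra instance). [folklore] -/
def ratPtV (hQU : Q.left (closedPoint L) ∈ U) : ↥(fieldPointFst X π ⁻¹ᵁ U) :=
  ⟨ratPtPoint X π Q, ratPtPoint_mem X π Q hQU⟩

/-- A section vanishes at the rational point iff its germ there is not a unit (the evaluation is a
local homomorphism `𝒪_{X_L, pt} → L` after the germ). [folklore] -/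
theorem evalRatPt_eq_zero_iff (hQU : Q.left (closedPoint L) ∈ U)
    (s : Γ((X ⊗ Over.mk π).left, fieldPointFst X π ⁻¹ᵁ U)) :
    evalRatPt X π Q hQU s = 0 ↔
      ¬ IsUnit ((X ⊗ Over.mk π).left.presheaf.germ (fieldPointFst X π ⁻¹ᵁ U)
        (ratPtV X π Q hQU : (X ⊗ Over.mk π).left) (ratPtV X π Q hQU).2 s) := by
  set g : (X ⊗ Over.mk π).left.presheaf.stalk (ratPt X π Q (closedPoint L)) :=
    (X ⊗ Over.mk π).left.presheaf.germ (fieldPointFst X π ⁻¹ᵁ U)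
      (ratPtV X π Q hQU : (X ⊗ Over.mk π).left) (ratPtV X π Q hQU).2 s with hg
  have e : evalRatPt X π Q hQU s = (Scheme.stalkClosedPointTo (ratPt X π Q)).hom g := rfl
  rw [e]
  haveI : IsLocalHom (Scheme.stalkClosedPointTo (ratPt X π Q)).hom :=
    Scheme.isLocalHom_stalkClosedPointTo' (ratPt X π Q)
  have key := isUnit_map_iff (Scheme.stalkClosedPointTo (ratPt X π Q)).hom g
  rw [isUnit_iff_ne_zero] at key
  tauto

/-- **The kernel of the evaluation is the prime ideal of the rational point** on the affine chart
`pr⁻¹U`. [folklore] -/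
theorem ker_evalRatPt_eq_primeIdealOf (hU : IsAffineOpen U) (hQU : Q.left (closedPoint L) ∈ U) :
    RingHom.ker (evalRatPt X π Q hQU) =
      ((isAffineOpen_preimage_fieldPointFst X π U hU).primeIdealOf (ratPtV X π Q hQU)).asIdeal := by
  set hS := isAffineOpen_preimage_fieldPointFst X π U hU
  ext s
  rw [RingHom.mem_ker, evalRatPt_eq_zero_iff]
  haveI := hS.isLocalization_stalk (ratPtV X π Q hQU)
  rw [← IsLocalization.AtPrime.to_map_mem_maximal_iff
      ((X ⊗ Over.mk π).left.presheaf.stalk (ratPtV X π Q hQU : (X ⊗ Over.mk π).left))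
      (hS.primeIdealOf (ratPtV X π Q hQU)).asIdeal s,
    IsLocalRing.mem_maximalIdeal, mem_nonunits_iff, RatFn.algebraMap_stalk_eq_germ]

/-- **Off the rational point some `k_a` is a unit**: for `y ∈ pr⁻¹U` other than the rational point,
the germ at `y` of one of the functions `pr^♯(a) − a(Q)` is a unit (their ideal is the maximal ideal
of the rational point, `ker_evalRatPt_eq_span`). [folklore] -/
theorem exists_isUnit_germ_kFun (hU : IsAffineOpen U) (hQU : Q.left (closedPoint L) ∈ U)
    (y : ↥(fieldPointFst X π ⁻¹ᵁ U)) (hne : (y : (X ⊗ Over.mk π).left) ≠ ratPtPoint X π Q) :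
    ∃ a : Γ(X.left, U), IsUnit ((X ⊗ Over.mk π).left.presheaf.germ (fieldPointFst X π ⁻¹ᵁ U)
      (y : (X ⊗ Over.mk π).left) y.2 (kFun X π Q hQU a)) := by
  set hS := isAffineOpen_preimage_fieldPointFst X π U hU
  by_contra h
  push Not at h
  haveI := hS.isLocalization_stalk y
  -- all `k_a` lie in `𝔭_y`
  have hle : Ideal.span (Set.range (kFun X π Q hQU)) ≤ (hS.primeIdealOf y).asIdeal := by
    rw [Ideal.span_le]
    rintro _ ⟨a, rfl⟩
    have := h a
    rw [← RatFn.algebraMap_stalk_eq_germ, IsLocalization.AtPrime.isUnit_to_map_iff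
      ((X ⊗ Over.mk π).left.presheaf.stalk (y : (X ⊗ Over.mk π).left)) (hS.primeIdealOf y).asIdeal] at this
    exact not_not.mp this
  rw [← ker_evalRatPt_eq_span X π Q hU hQU] at hle
  -- the kernel is maximal, hence equal to `𝔭_y`, hence `𝔭_y = 𝔭_{pt}`
  have hmax : (RingHom.ker (evalRatPt X π Q hQU)).IsMaximal :=
    RingHom.ker_isMaximal_of_surjective _ (evalRatPt_surjective X π Q hQU)
  have heq : RingHom.ker (evalRatPt X π Q hQU) = (hS.primeIdealOf y).asIdeal :=
    hmax.eq_of_le (hS.primeIdealOf y).isPrime.ne_top hle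
  rw [ker_evalRatPt_eq_primeIdealOf X π Q hU hQU] at heq
  have hpt : hS.primeIdealOf (ratPtV X π Q hQU) = hS.primeIdealOf y := PrimeSpectrum.ext heq
  have := congrArg hS.fromSpec hpt
  rw [hS.fromSpec_primeIdealOf, hS.fromSpec_primeIdealOf] at this
  exact hne this.symm

/-- **At the rational point the `k_a` generate the maximal ideal** of `𝒪_{X_L, pt}`. [folklore] -/
theorem span_germ_kFun_eq_maximalIdeal (hU : IsAffineOpen U) (hQU : Q.left (closedPoint L) ∈ U) :
    Ideal.span (Set.range fun a : Γ(X.left, U) ↦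
      (X ⊗ Over.mk π).left.presheaf.germ (fieldPointFst X π ⁻¹ᵁ U)
        (ratPtV X π Q hQU : (X ⊗ Over.mk π).left) (ratPtV X π Q hQU).2 (kFun X π Q hQU a)) =
      maximalIdeal ((X ⊗ Over.mk π).left.presheaf.stalk (ratPtV X π Q hQU : (X ⊗ Over.mk π).left)) := by
  set hS := isAffineOpen_preimage_fieldPointFst X π U hU
  haveI := hS.isLocalization_stalk (ratPtV X π Q hQU)
  have h1 := IsLocalization.AtPrime.map_eq_maximalIdeal (hS.primeIdealOf (ratPtV X π Q hQU)).asIdeal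
    ((X ⊗ Over.mk π).left.presheaf.stalk (ratPtV X π Q hQU : (X ⊗ Over.mk π).left))
  rw [← h1, ← ker_evalRatPt_eq_primeIdealOf X π Q hU hQU, ker_evalRatPt_eq_span X π Q hU hQU,
    Ideal.map_span]
  congr 1
  ext t
  simp only [Set.mem_image, Set.mem_range, exists_exists_eq_and]
  refine exists_congr fun a ↦ ?_
  rw [RatFn.algebraMap_stalk_eq_germ]

end FieldPoint

end Literature.AlgebraicGeometry.Motives
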